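import Literature.NumberTheory.ModularForms.PoincareSeriesWeightTwoFourierModes
import Literature.NumberTheory.ModularForms.PoincareSeriesWeightTwoCosetModes
import Literature.NumberTheory.ModularForms.PoincareSeriesWeightTwoHeckeSqIntegrable
import HarnessLib

/-!
# Uniform domination of the weight-2 Hecke–Poincaré series of prime level on `0 < s ≤ 1`
# (Iwaniec–Kowalski §14.1–§14.2, `k = 2`, Hecke's trick §3.2)

Topic `Literature/NumberTheory/ModularForms` (namespace `Literature.NumberTheory.ModularForms.PoincareWeightTwo`).
THEOREMS ONLY; no definition, no named fact. For a PRIME level `q` and `m ≥ 1` the functions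
`E_s = yˢ P_m(·, s)`, `0 < s ≤ 1`, satisfy

  `sup_{0 < s ≤ 1} sup_{w ∈ ℍ} (Im w)^{1+s} |P_m(w, s)| < ∞`   (`exists_bound_rpow_im_mul_norm_prime`),

hence their Petersson square-integrands `Σ_q |E_s(q⁻¹τ)|² (Im q⁻¹τ)²` on the standard fundamental
domain `𝒟` are dominated by ONE constant, integrable since `vol(𝒟) < ∞` — conjunct (iii) of
`HeckeDomination` of the I1 skeleton
`Summits/Parity/GeneralizedHardyLittlewood/Cruxes/PeterssonBoundPrinted/Lines/poincare_hecke.lean` at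
prime level (`heckeMajorant_prime`, the registered stub `stub_heckeMajorantPrime`), and with the tree's
items (i) `continuous_rpow_im_mul_poincareHecke`, (ii) `peterssonSqIntegrable_rpow_im_mul_poincareHecke`
the whole of `HeckeDomination` at prime level (`heckeDomination_prime`).

The uniformity in `s` (the trivial Eisenstein majorant grows like `1/s`) comes from Weil's bound in the
Fourier expansions at BOTH cusps of `Γ₀(q)`: at `∞` (`norm_poincareHecke_le_of_modes` with the
proved modes `heckeFourierModes`) and at `0` through the coset series of `Γ₀(q)S`
(`poincareHecke_S_smul`, `norm_cosetP_le`); the two are patched by the `Γ₀(q)`-invariance of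
`(Im)^{1+s}|P_m|` and the decomposition `SL₂(ℤ) = Γ₀(q) ⊔ ⨆_j Γ₀(q) S Tʲ` (`q` prime), every point of
`ℍ` being an `SL₂(ℤ)`-translate of a point of `𝒟` (`Im ≥ √3/2`).

## References

* [IwaniecKowalski2004] H. Iwaniec, E. Kowalski, *Analytic Number Theory*, AMS Colloq. Publ. 53,
  §14.1 (14.4)–(14.5), (14.11), §14.2 (proof of Lemma 14.2), §3.2.
* [Iwaniec2002] H. Iwaniec, *Spectral Methods of Automorphic Forms*, §2.4 (cusps of `Γ₀(q)`), §3.4 (3.17).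
-/

noncomputable section

open scoped MatrixGroups Real
open CongruenceSubgroup Complex MeasureTheory Filter Set
open UpperHalfPlane hiding I

namespace Literature.NumberTheory.ModularForms.PoincareWeightTwo

variable {N : ℕ} [NeZero N]

/-! ## `(Im)^{1+s}|P_m|` under `Γ₀(N)` and under `S` -/

/-- The algebra of the weight: `(y/D²)^{1+s} · (D² D^{2s} X) = y^{1+s} X` (`y, D > 0`). [folklore] -/
private theorem div_sq_rpow_mul {y D X s : ℝ} (hy : 0 < y) (hD : 0 < D) :
    (y / D ^ 2) ^ (1 + s) * (D ^ 2 * D ^ (2 * s) * X) = y ^ (1 + s) * X := by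
  have hD2 : 0 < D ^ 2 := by positivity
  rw [Real.div_rpow hy.le hD2.le]
  have h1 : (D ^ 2) ^ (1 + s) = D ^ 2 * D ^ (2 * s) := by
    rw [Real.rpow_add hD2, Real.rpow_one, ← Real.rpow_natCast D 2, ← Real.rpow_mul hD.le]
    norm_num
  rw [h1]
  field_simp

omit [NeZero N] in
/-- **`Γ₀(N)`-invariance of `(Im z)^{1+s} |P_m(z,s)|`** (weight-`(2,s)` automorphy and
`Im γz = Im z/|cz+d|²`). [cite: IwaniecKowalski2004, §14.1 (14.4) with §3.2] -/
theorem rpow_im_mul_norm_poincareHecke_smul (m : ℕ) (s : ℝ) {γ : SL(2, ℤ)} (hγ : γ ∈ Gamma0 N)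
    (z : ℍ) :
    (γ • z).im ^ (1 + s) * ‖poincareHecke N m s (γ • z)‖ = z.im ^ (1 + s) * ‖poincareHecke N m s z‖ := by
  have hd : denom γ z ≠ 0 := denom_ne_zero γ z
  have hD : 0 < ‖denom γ z‖ := norm_pos_iff.mpr hd
  rw [poincareHecke_smul_denom m s γ hγ z, ModularGroup.im_smul_eq_div_normSq, Complex.normSq_eq_norm_sq,
    norm_mul, norm_mul, norm_pow, Complex.norm_real, Real.norm_of_nonneg (Real.rpow_nonneg hD.le _)]
  exact div_sq_rpow_mul z.im_pos hD

omit [NeZero N] in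
/-- **At the cusp `0`**: `(Im Sw)^{1+s} |P_m(Sw, s)| = (Im w)^{1+s} |cosetP(w, s)|`
(`P_m(Sw,s) = w²|w|^{2s} cosetP(w,s)`, `Im Sw = Im w/|w|²`). [cite: IwaniecKowalski2004, §14.1 (14.4) (at the cusp 0)] -/
theorem rpow_im_mul_norm_poincareHecke_S_smul (m : ℕ) (s : ℝ) (w : ℍ) :
    (ModularGroup.S • w).im ^ (1 + s) * ‖poincareHecke N m s (ModularGroup.S • w)‖ =
      w.im ^ (1 + s) * ‖cosetP N m s w‖ := by
  have hw : (w : ℂ) ≠ 0 := ne_zero w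
  have hD : 0 < ‖(w : ℂ)‖ := norm_pos_iff.mpr hw
  have hden : denom (ModularGroup.S : SL(2, ℤ)) w = (w : ℂ) := by
    rw [ModularGroup.denom_apply, ModularGroup.coe_S]; simp
  rw [poincareHecke_S_smul m s w, ModularGroup.im_smul_eq_div_normSq, hden, Complex.normSq_eq_norm_sq,
    norm_mul, norm_mul, norm_pow, Complex.norm_real, Real.norm_of_nonneg (Real.rpow_nonneg hD.le _)]
  exact div_sq_rpow_mul w.im_pos hD

/-! ## `SL₂(ℤ) = Γ₀(q) ⊔ ⨆_j Γ₀(q) S Tʲ` for `q` prime -/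

/-- **The cosets of `Γ₀(q)` in `SL₂(ℤ)` for `q` prime**: every `δ ∈ SL₂(ℤ)` lies in `Γ₀(q)` or is
`γ S Tʲ` with `γ ∈ Γ₀(q)`, `j ∈ ℤ` (`j ≡ d c⁻¹ (mod q)` when `q ∤ c`).
[cite: Iwaniec2002, §2.4 (Γ₀(q) has the two cusps ∞, 0 for q prime)] -/
theorem mem_Gamma0_or_eq_mul_S_mul_T_zpow {p : ℕ} (hp : p.Prime) (δ : SL(2, ℤ)) :
    δ ∈ Gamma0 p ∨ ∃ γ : SL(2, ℤ), γ ∈ Gamma0 p ∧ ∃ j : ℤ, δ = γ * ModularGroup.S * ModularGroup.T ^ j := by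
  haveI := Fact.mk hp
  by_cases hc : ((δ 1 0 : ℤ) : ZMod p) = 0
  · left; exact Gamma0_mem.mpr hc
  · right
    set j : ℤ := (δ 1 1 : ℤ) * (((((δ 1 0 : ℤ) : ZMod p))⁻¹).val : ℤ) with hj
    refine ⟨δ * (ModularGroup.T ^ j)⁻¹ * ModularGroup.S⁻¹, ?_, j, by group⟩
    rw [Gamma0_mem]
    have hentry : ((δ * (ModularGroup.T ^ j)⁻¹ * ModularGroup.S⁻¹ : SL(2, ℤ)) 1 0 : ℤ) =
        (δ 1 0 : ℤ) * j - δ 1 1 := by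
      rw [← zpow_neg, Matrix.SpecialLinearGroup.coe_mul, Matrix.SpecialLinearGroup.coe_mul,
        Matrix.SpecialLinearGroup.coe_inv, ModularGroup.coe_T_zpow, ModularGroup.coe_S,
        Matrix.adjugate_fin_two]
      simp [Matrix.mul_apply, Fin.sum_univ_two]
      ring
    rw [hentry]
    push_cast
    rw [hj]
    push_cast
    rw [ZMod.natCast_zmod_val, ← mul_assoc, mul_comm ((δ 1 0 : ℤ) : ZMod p), mul_assoc,
      mul_inv_cancel₀ hc, mul_one, sub_self]

/-! ## Elementary bounds on `1/2 ≤ y`, `0 < s ≤ 1` -/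

omit [NeZero N] in
/-- `y^{1+s} e^{−2πmy} ≤ 1` for `y > 0`, `0 ≤ s ≤ 1`, `m ≥ 1` (`e^{x} ≥ 1 + x²/2`). [folklore] -/
private theorem rpow_mul_exp_neg_le_one {y s : ℝ} (hy : 0 < y) (hs0 : 0 ≤ s) (hs1 : s ≤ 1) {m : ℕ}
    (hm : 1 ≤ m) : y ^ (1 + s) * Real.exp (-(2 * π * m * y)) ≤ 1 := by
  have hm1 : (1 : ℝ) ≤ m := by exact_mod_cast hm
  have hx : 0 ≤ 2 * π * m * y := by positivity
  have hexp : 1 + y ^ 2 ≤ Real.exp (2 * π * m * y) := by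
    have h := Real.quadratic_le_exp_of_nonneg hx
    have hπ : 3 ≤ π := by linarith [Real.pi_gt_three]
    have hπm : 1 ≤ π * m := by nlinarith
    have h1 : (2 * π * m * y) ^ 2 / 2 = 2 * (π * m) ^ 2 * y ^ 2 := by ring
    have h2 : (1 : ℝ) ≤ (π * m) ^ 2 := by nlinarith
    have h3 : y ^ 2 ≤ (2 * π * m * y) ^ 2 / 2 := by rw [h1]; nlinarith [sq_nonneg y]
    linarith
  have hpow : y ^ (1 + s) ≤ 1 + y ^ 2 := by
    rcases le_or_gt y 1 with h | h
    · calc y ^ (1 + s) ≤ 1 := Real.rpow_le_one hy.le h (by linarith)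
        _ ≤ 1 + y ^ 2 := by nlinarith [sq_nonneg y]
    · calc y ^ (1 + s) ≤ y ^ (2 : ℝ) := Real.rpow_le_rpow_of_exponent_le h.le (by linarith)
        _ = y ^ 2 := by rw [Real.rpow_two]
        _ ≤ 1 + y ^ 2 := by linarith
  rw [Real.exp_neg]
  have hE : 0 < Real.exp (2 * π * m * y) := Real.exp_pos _
  rw [mul_inv_le_iff₀ hE, one_mul]
  exact hpow.trans hexp

omit [NeZero N] in
/-- `y^{1+s} · (2π/y)(y/2)^{−2s} ≤ 16π` for `y ≥ 1/2`, `0 ≤ s ≤ 1`. [folklore] -/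
private theorem rpow_mul_modeFactor_le {y s : ℝ} (hy : 1 / 2 ≤ y) (hs0 : 0 ≤ s) (hs1 : s ≤ 1) :
    y ^ (1 + s) * (2 * π / y * (y / 2) ^ (-(2 * s))) ≤ 16 * π := by
  have hy0 : 0 < y := by linarith
  have h1 : y ^ (1 + s) * (2 * π / y * (y / 2) ^ (-(2 * s))) = 2 * π * (y ^ (-s) * 2 ^ (2 * s)) := by
    rw [Real.div_rpow hy0.le (by norm_num : (0 : ℝ) ≤ 2), Real.rpow_neg hy0.le, Real.rpow_neg hy0.le,
      Real.rpow_neg (by norm_num : (0 : ℝ) ≤ 2), Real.rpow_add hy0, Real.rpow_one]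
    have : y ^ (2 * s) = y ^ s * y ^ s := by rw [← Real.rpow_add hy0]; ring_nf
    rw [this]
    have hys : 0 < y ^ s := Real.rpow_pos_of_pos hy0 s
    have h2s : 0 < (2 : ℝ) ^ (2 * s) := Real.rpow_pos_of_pos (by norm_num) _
    field_simp
  rw [h1]
  have hys : y ^ (-s) ≤ 2 := by
    calc y ^ (-s) ≤ (1 / 2 : ℝ) ^ (-s) := Real.rpow_le_rpow_of_nonpos (by norm_num) hy (by linarith)
      _ = 2 ^ s := by rw [Real.div_rpow zero_le_one (by norm_num), Real.one_rpow, Real.rpow_neg (by norm_num)]; field_simp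
      _ ≤ 2 ^ (1 : ℝ) := Real.rpow_le_rpow_of_exponent_le (by norm_num) hs1
      _ = 2 := Real.rpow_one 2
  have h22 : (2 : ℝ) ^ (2 * s) ≤ 4 := by
    calc (2 : ℝ) ^ (2 * s) ≤ 2 ^ (2 : ℝ) := Real.rpow_le_rpow_of_exponent_le (by norm_num) (by linarith)
      _ = 4 := by norm_num
  have : y ^ (-s) * 2 ^ (2 * s) ≤ 2 * 4 :=
    mul_le_mul hys h22 (Real.rpow_nonneg (by norm_num) _) (by norm_num)
  nlinarith [Real.pi_pos]

omit [NeZero N] in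
/-- Monotonicity of the geometric sums `Σ_{n∈ℤ} e^{−π c |n| y}` in `y`. [folklore] -/
private theorem tsum_exp_le_of_le {c y y₀ : ℝ} (hc : 0 ≤ c) (h : y₀ ≤ y)
    (hsum : Summable fun n : ℤ ↦ Real.exp (-(π * (c * |(n : ℝ)|) * y₀))) :
    ∑' n : ℤ, Real.exp (-(π * (c * |(n : ℝ)|) * y)) ≤ ∑' n : ℤ, Real.exp (-(π * (c * |(n : ℝ)|) * y₀)) := by
  have hle : ∀ n : ℤ, Real.exp (-(π * (c * |(n : ℝ)|) * y)) ≤ Real.exp (-(π * (c * |(n : ℝ)|) * y₀)) := by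
    intro n
    apply Real.exp_le_exp.mpr
    have : 0 ≤ π * (c * |(n : ℝ)|) := by positivity
    nlinarith
  exact (hsum.of_nonneg_of_le (fun _ ↦ (Real.exp_pos _).le) hle).tsum_le_tsum hle hsum

omit [NeZero N] in
/-- Summability of `n ↦ e^{−π c |n| y}` over `ℤ` for `c, y > 0`. [folklore] -/
private theorem summable_exp_abs {c y : ℝ} (hc : 0 < c) (hy : 0 < y) :
    Summable fun n : ℤ ↦ Real.exp (-(π * (c * |(n : ℝ)|) * y)) := by
  have hq : Real.exp (-(π * c * y)) < 1 := Real.exp_lt_one_iff.mpr (by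
    have : 0 < π * c * y := by positivity
    linarith)
  have hq0 : 0 ≤ Real.exp (-(π * c * y)) := (Real.exp_pos _).le
  have hnat : Summable fun k : ℕ ↦ Real.exp (-(π * (c * |((k : ℤ) : ℝ)|) * y)) := by
    refine (summable_geometric_of_lt_one hq0 hq).congr fun k ↦ ?_
    rw [← Real.exp_nat_mul]
    congr 1
    push_cast
    rw [abs_of_nonneg (by positivity : (0 : ℝ) ≤ (k : ℝ))]
    ring
  refine Summable.of_nat_of_neg hnat ?_
  refine hnat.congr fun k ↦ ?_
  push_cast
  rw [abs_neg]

/-! ## The uniform bound at the cusp `∞` -/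

/-- **At the cusp `∞`**: for `0 < s ≤ 1`, `m ≥ 1` and `Im z ≥ 1/2`,
`(Im z)^{1+s} |P_m(z, s)| ≤ 1 + 16π · W · L`, `W = Σ_r cellMajorant N m r`,
`L = Σ_{n∈ℤ} e^{−π|n|/2}` (Fourier expansion at `∞` with the proved modes `heckeFourierModes`).
[cite: IwaniecKowalski2004, §14.2 (proof of Lemma 14.2)] -/
theorem rpow_im_mul_norm_poincareHecke_le {m : ℕ} (hm : 1 ≤ m) {s : ℝ} (hs : 0 < s) (hs1 : s ≤ 1)
    (z : ℍ) (hz : 1 / 2 ≤ z.im) :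
    z.im ^ (1 + s) * ‖poincareHecke N m s z‖ ≤
      1 + 16 * π * (∑' r : ℕ, cellMajorant N m r) *
        ∑' n : ℤ, Real.exp (-(π * (1 * |(n : ℝ)|) * (1 / 2))) := by
  have hy : 0 < z.im := z.im_pos
  have hmodes := fun n : ℤ ↦ (heckeFourierModes N m hm s hs n z.im hy).2
  have h := norm_poincareHecke_le_of_modes hm hs z (fun n ↦ by rw [hmodes n]; rfl)
  have hW : 0 ≤ ∑' r : ℕ, cellMajorant N m r := tsum_nonneg fun r ↦ cellMajorant_nonneg (N := N) m r
  have hL := tsum_exp_le_of_le (c := 1) zero_le_one hz (summable_exp_abs one_pos (by norm_num))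
  have hL' : ∑' n : ℤ, Real.exp (-(π * |(n : ℝ)| * z.im)) ≤
      ∑' n : ℤ, Real.exp (-(π * (1 * |(n : ℝ)|) * (1 / 2))) := by
    refine le_trans (le_of_eq (tsum_congr fun n ↦ by rw [one_mul])) hL
  have hpos : 0 ≤ z.im ^ (1 + s) := Real.rpow_nonneg hy.le _
  calc z.im ^ (1 + s) * ‖poincareHecke N m s z‖
      ≤ z.im ^ (1 + s) * (Real.exp (-(2 * π * m * z.im)) +
          (∑' r : ℕ, cellMajorant N m r) * (2 * π / z.im * (z.im / 2) ^ (-(2 * s))) *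
            ∑' n : ℤ, Real.exp (-(π * |(n : ℝ)| * z.im))) := mul_le_mul_of_nonneg_left h hpos
    _ = z.im ^ (1 + s) * Real.exp (-(2 * π * m * z.im)) +
          (z.im ^ (1 + s) * (2 * π / z.im * (z.im / 2) ^ (-(2 * s)))) *
            (∑' r : ℕ, cellMajorant N m r) * ∑' n : ℤ, Real.exp (-(π * |(n : ℝ)| * z.im)) := by ring
    _ ≤ 1 + 16 * π * (∑' r : ℕ, cellMajorant N m r) *
          ∑' n : ℤ, Real.exp (-(π * (1 * |(n : ℝ)|) * (1 / 2))) := by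
        have h1 := rpow_mul_exp_neg_le_one hy hs.le hs1 hm
        have h2 := rpow_mul_modeFactor_le hz hs.le hs1
        have hL0 : 0 ≤ ∑' n : ℤ, Real.exp (-(π * |(n : ℝ)| * z.im)) :=
          tsum_nonneg fun n ↦ (Real.exp_pos _).le
        refine add_le_add h1 (mul_le_mul (mul_le_mul_of_nonneg_right h2 hW) hL' hL0 ?_)
        positivity

/-! ## The uniform bound at the cusp `0` -/

/-- **At the cusp `0`** (`N ≥ 2`): for `0 < s ≤ 1`, `m ≥ 1` and `Im w ≥ 1/2`,
`(Im w)^{1+s} |cosetP(w, s)| ≤ 16π · (W'/N) · L'`, `W' = Σ_a cellMajorant 1 m (a+1)`,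
`L' = Σ_{n∈ℤ} e^{−π(|n|/N)/2}`. [cite: Iwaniec2002, §3.4 (3.17)] -/
theorem rpow_im_mul_norm_cosetP_le (hN : 2 ≤ N) {m : ℕ} (hm : 1 ≤ m) {s : ℝ} (hs : 0 < s) (hs1 : s ≤ 1)
    (w : ℍ) (hw : 1 / 2 ≤ w.im) :
    w.im ^ (1 + s) * ‖cosetP N m s w‖ ≤
      16 * π * ((∑' a : {r : ℕ // Nat.Coprime (r + 1) N}, cellMajorant 1 m (a.1 + 1)) / N) *
        ∑' n : ℤ, Real.exp (-(π * ((1 / N) * |(n : ℝ)|) * (1 / 2))) := by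
  have hy : 0 < w.im := w.im_pos
  have hN0 : (0 : ℝ) < N := by exact_mod_cast (by omega : 0 < N)
  have h := norm_cosetP_le hN hm hs w
  have hW : 0 ≤ (∑' a : {r : ℕ // Nat.Coprime (r + 1) N}, cellMajorant 1 m (a.1 + 1)) / N :=
    div_nonneg (tsum_nonneg fun a ↦ cellMajorant_nonneg (N := 1) m _) hN0.le
  have hL := tsum_exp_le_of_le (c := 1 / N) (by positivity) hw
    (summable_exp_abs (by positivity) (by norm_num))
  have hL' : ∑' n : ℤ, Real.exp (-(π * |(n : ℝ) / N| * w.im)) ≤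
      ∑' n : ℤ, Real.exp (-(π * ((1 / N) * |(n : ℝ)|) * (1 / 2))) := by
    refine le_trans (le_of_eq (tsum_congr fun n ↦ ?_)) hL
    rw [abs_div, abs_of_pos hN0]; ring_nf
  have hpos : 0 ≤ w.im ^ (1 + s) := Real.rpow_nonneg hy.le _
  calc w.im ^ (1 + s) * ‖cosetP N m s w‖
      ≤ w.im ^ (1 + s) * ((∑' a : {r : ℕ // Nat.Coprime (r + 1) N}, cellMajorant 1 m (a.1 + 1)) / N *
          (2 * π / w.im * (w.im / 2) ^ (-(2 * s))) *
            ∑' n : ℤ, Real.exp (-(π * |(n : ℝ) / N| * w.im))) := mul_le_mul_of_nonneg_left h hpos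
    _ = (w.im ^ (1 + s) * (2 * π / w.im * (w.im / 2) ^ (-(2 * s)))) *
          ((∑' a : {r : ℕ // Nat.Coprime (r + 1) N}, cellMajorant 1 m (a.1 + 1)) / N) *
            ∑' n : ℤ, Real.exp (-(π * |(n : ℝ) / N| * w.im)) := by ring
    _ ≤ 16 * π * ((∑' a : {r : ℕ // Nat.Coprime (r + 1) N}, cellMajorant 1 m (a.1 + 1)) / N) *
          ∑' n : ℤ, Real.exp (-(π * ((1 / N) * |(n : ℝ)|) * (1 / 2))) := by
        have h2 := rpow_mul_modeFactor_le hw hs.le hs1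
        have hL0 : 0 ≤ ∑' n : ℤ, Real.exp (-(π * |(n : ℝ) / N| * w.im)) :=
          tsum_nonneg fun n ↦ (Real.exp_pos _).le
        refine mul_le_mul (mul_le_mul_of_nonneg_right h2 hW) hL' hL0 ?_
        positivity

/-! ## The uniform bound on all of `ℍ` for prime level -/

/-- **`sup_{0 < s ≤ 1, w ∈ ℍ} (Im w)^{1+s} |P_m(w,s)| < ∞` for prime level** (`m ≥ 1`): every `w` is
`δ⁻¹τ` with `τ ∈ 𝒟` (`Im τ ≥ √3/2`), `δ ∈ Γ₀(q)` or `δ = γSTʲ`; in the first case the invariance and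
the bound at `∞` apply, in the second `(Im)^{1+s}|P_m|(STʲτ) = (Im τ)^{1+s}|cosetP(Tʲτ)|` and the bound
at `0` applies. [cite: IwaniecKowalski2004, §14.1–§14.2 (k = 2, Hecke's trick)] -/
theorem exists_bound_rpow_im_mul_norm_prime (hp : N.Prime) {m : ℕ} (hm : 1 ≤ m) :
    ∃ B : ℝ, 0 ≤ B ∧ ∀ s : ℝ, 0 < s → s ≤ 1 → ∀ w : ℍ,
      w.im ^ (1 + s) * ‖poincareHecke N m s w‖ ≤ B := by
  have hN2 : 2 ≤ N := hp.two_le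
  set B₁ : ℝ := 1 + 16 * π * (∑' r : ℕ, cellMajorant N m r) *
    ∑' n : ℤ, Real.exp (-(π * (1 * |(n : ℝ)|) * (1 / 2))) with hB₁
  set B₂ : ℝ := 16 * π * ((∑' a : {r : ℕ // Nat.Coprime (r + 1) N}, cellMajorant 1 m (a.1 + 1)) / N) *
    ∑' n : ℤ, Real.exp (-(π * ((1 / N) * |(n : ℝ)|) * (1 / 2))) with hB₂
  have hB₁0 : 0 ≤ B₁ := by
    have : 0 ≤ ∑' r : ℕ, cellMajorant N m r := tsum_nonneg fun r ↦ cellMajorant_nonneg (N := N) m r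
    have : 0 ≤ ∑' n : ℤ, Real.exp (-(π * (1 * |(n : ℝ)|) * (1 / 2))) := tsum_nonneg fun n ↦ (Real.exp_pos _).le
    positivity
  refine ⟨max B₁ B₂, le_max_of_le_left hB₁0, fun s hs hs1 w ↦ ?_⟩
  -- move `w` to the fundamental domain
  obtain ⟨g, hg⟩ := ModularGroup.exists_smul_mem_fd w
  set τ : ℍ := g • w with hτ
  have hwτ : w = g⁻¹ • τ := by rw [hτ, inv_smul_smul]
  have hτim : 1 / 2 ≤ τ.im := by
    have h3 := ModularGroup.three_le_four_mul_im_sq_of_mem_fd hg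
    nlinarith [τ.im_pos]
  rcases mem_Gamma0_or_eq_mul_S_mul_T_zpow hp g⁻¹ with hmem | ⟨γ, hγ, j, hj⟩
  · rw [hwτ, rpow_im_mul_norm_poincareHecke_smul m s hmem]
    exact (rpow_im_mul_norm_poincareHecke_le hm hs hs1 τ hτim).trans (le_max_left _ _)
  · rw [hwτ, hj, mul_smul, mul_smul, rpow_im_mul_norm_poincareHecke_smul m s hγ,
      rpow_im_mul_norm_poincareHecke_S_smul, UpperHalfPlane.modular_T_zpow_smul]
    have him : (((j : ℝ)) +ᵥ τ : ℍ).im = τ.im := UpperHalfPlane.vadd_im _ _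
    rw [him]
    have h2 := rpow_im_mul_norm_cosetP_le hN2 hm hs hs1 (((j : ℝ)) +ᵥ τ) (by rw [him]; exact hτim)
    rw [him] at h2
    exact h2.trans (le_max_right _ _)

/-! ## Conjunct (iii) of `HeckeDomination` at prime level, and the whole of it -/

/-- **Uniform domination of the Petersson square-integrands at prime level** (conjunct (iii) of
`HeckeDomination` of the I1 skeleton `poincare_hecke`, prime level — the registered stub
`stub_heckeMajorantPrime`): for `q` prime and `m ≥ 1` there is ONE integrable `G` on `𝒟` (a constant,
`vol(𝒟) < ∞`) with `Σ_q |E_s(q⁻¹τ)|² (Im q⁻¹τ)² ≤ G(τ)` for all `0 < s ≤ 1`, `τ ∈ 𝒟`, `E_s = yˢP_m(·,s)`.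
[cite: IwaniecKowalski2004, §14.1–§14.2 (k = 2, Hecke's trick §3.2)] -/
theorem heckeMajorant_prime :
    ∀ (N : ℕ) [NeZero N], N.Prime → ∀ (m : ℕ), 1 ≤ m →
      ∃ G : ℍ → ℝ, IntegrableOn G ModularGroup.fd ∧
        letI := Fintype.ofFinite (𝒮ℒ ⧸ (Gamma0 N : Subgroup (GL (Fin 2) ℝ)).subgroupOf 𝒮ℒ)
        ∀ s : ℝ, 0 < s → s ≤ 1 → ∀ τ ∈ ModularGroup.fd,
          ∑ q : 𝒮ℒ ⧸ (Gamma0 N : Subgroup (GL (Fin 2) ℝ)).subgroupOf 𝒮ℒ,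
            ‖(fun z : ℍ ↦ ((z.im ^ s : ℝ) : ℂ) * poincareHecke N m s z)
                (((q.out : 𝒮ℒ) : GL (Fin 2) ℝ)⁻¹ • τ)‖ ^ 2 *
              ((((q.out : 𝒮ℒ) : GL (Fin 2) ℝ)⁻¹ • τ).im) ^ (2 : ℤ) ≤ G τ := by
  intro N _ hp m hm
  letI := Fintype.ofFinite (𝒮ℒ ⧸ (Gamma0 N : Subgroup (GL (Fin 2) ℝ)).subgroupOf 𝒮ℒ)
  obtain ⟨B, hB0, hB⟩ := exists_bound_rpow_im_mul_norm_prime (N := N) hp hm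
  refine ⟨fun _ ↦ (Fintype.card (𝒮ℒ ⧸ (Gamma0 N : Subgroup (GL (Fin 2) ℝ)).subgroupOf 𝒮ℒ) : ℝ) * B ^ 2,
    integrableOn_const (Literature.NumberTheory.EllipticCurves.ModularForms.volume_fd_lt_top).ne,
    fun s hs hs1 τ _ ↦ ?_⟩
  calc ∑ q : 𝒮ℒ ⧸ (Gamma0 N : Subgroup (GL (Fin 2) ℝ)).subgroupOf 𝒮ℒ,
        ‖(fun z : ℍ ↦ ((z.im ^ s : ℝ) : ℂ) * poincareHecke N m s z)
            (((q.out : 𝒮ℒ) : GL (Fin 2) ℝ)⁻¹ • τ)‖ ^ 2 *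
          ((((q.out : 𝒮ℒ) : GL (Fin 2) ℝ)⁻¹ • τ).im) ^ (2 : ℤ)
      ≤ ∑ _q : 𝒮ℒ ⧸ (Gamma0 N : Subgroup (GL (Fin 2) ℝ)).subgroupOf 𝒮ℒ, B ^ 2 := by
        refine Finset.sum_le_sum fun q _ ↦ ?_
        simp only
        rw [norm_rpow_im_mul_poincareHecke_sq_mul]
        exact pow_le_pow_left₀ (mul_nonneg (Real.rpow_nonneg (UpperHalfPlane.im_pos _).le _)
          (norm_nonneg _)) (hB s hs hs1 _) 2
    _ = (Fintype.card (𝒮ℒ ⧸ (Gamma0 N : Subgroup (GL (Fin 2) ℝ)).subgroupOf 𝒮ℒ) : ℝ) * B ^ 2 := by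
        rw [Finset.sum_const, Finset.card_univ, nsmul_eq_mul]

/-- **`HeckeDomination` at prime level** (items (i) continuity — the tree's
`continuous_rpow_im_mul_poincareHecke` —, (ii) square-integrability for every `s > 0` — the tree's
`peterssonSqIntegrable_rpow_im_mul_poincareHecke` —, (iii) `heckeMajorant_prime`).
[cite: IwaniecKowalski2004, §14.1–§14.2 (k = 2, Hecke's trick §3.2)] -/
theorem heckeDomination_prime :
    ∀ (N : ℕ) [NeZero N], N.Prime → ∀ (m : ℕ), 1 ≤ m →
      (∀ s : ℝ, 0 < s → s ≤ 1 →
        Continuous (fun z : ℍ ↦ ((z.im ^ s : ℝ) : ℂ) * poincareHecke N m s z)) ∧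
      (∀ s : ℝ, 0 < s →
        PeterssonSqIntegrable N 2 (fun z : ℍ ↦ ((z.im ^ s : ℝ) : ℂ) * poincareHecke N m s z)) ∧
      ∃ G : ℍ → ℝ, IntegrableOn G ModularGroup.fd ∧
        letI := Fintype.ofFinite (𝒮ℒ ⧸ (Gamma0 N : Subgroup (GL (Fin 2) ℝ)).subgroupOf 𝒮ℒ)
        ∀ s : ℝ, 0 < s → s ≤ 1 → ∀ τ ∈ ModularGroup.fd,
          ∑ q : 𝒮ℒ ⧸ (Gamma0 N : Subgroup (GL (Fin 2) ℝ)).subgroupOf 𝒮ℒ,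
            ‖(fun z : ℍ ↦ ((z.im ^ s : ℝ) : ℂ) * poincareHecke N m s z)
                (((q.out : 𝒮ℒ) : GL (Fin 2) ℝ)⁻¹ • τ)‖ ^ 2 *
              ((((q.out : 𝒮ℒ) : GL (Fin 2) ℝ)⁻¹ • τ).im) ^ (2 : ℤ) ≤ G τ :=
  fun N _ hp m hm ↦ ⟨fun _ hs _ ↦ continuous_rpow_im_mul_poincareHecke m hs,
    fun s hs ↦ peterssonSqIntegrable_rpow_im_mul_poincareHecke N m hm s hs,
    heckeMajorant_prime N hp m hm⟩

end Literature.NumberTheory.ModularForms.PoincareWeightTwo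

end
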